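import Summits.BirchSwinnertonDyer.BirchSwinnertonDyer.Theorems.PrintCf2SplitBadTwoReductionTypesOverK
import Summits.BirchSwinnertonDyer.BirchSwinnertonDyer.Theorems.PrintCf2SplitBadTwoCMPrimaryConjugationTransport
import Literature.NumberTheory.ComplexMultiplication.ReflexNormIdeleCharacterOfModulus
import Literature.NumberTheory.DiophantineGeometry.AbcWave0GranvilleStarkTheorem2Proofs
import Literature.NumberTheory.QuadraticFields.DiscriminantOfSqrt
import HarnessLib

/-!
# Crux `PrintCf2.SplitBadTwoRankOneOfFacts` (stmt-BirchSwinnertonDyer-20368), road α v10.2 — brick B15 §2, file 3a: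
# ARITHMETIC OF THE FRAME FIELD `ℚ(√−7)`: units `±1`, the generator `β` of `v̄`, valuations at the places above `2`

Cell `bsd-print-cf2`, width seat `bsd-line-cf2-p1-w6` g2 (prover-bsd-line-cf2-p1-w6-g2-0); `--supports stmt-BirchSwinnertonDyer-20368`
(helper, Theses-free). HONEST FRAMING: nothing here closes the crux or a registered stub; BSD is not proved by any of this; no summit
statement is proved by this seat. No definition, no named fact, no `sorry`.

WHAT (inputs of file 3b `…FirstLayerOfFrame`: the first layer of every `ℤ₂`-line of the frame field unramified outside `v̄` is `K(√−β)`):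
* §1 the frame field `K` (imaginary quadratic, `θ² = −7`): `d_K = −7` (`discr_eq_neg_seven`), `h_K = 1` (`isPrincipalIdealRing_of_sq_eq_neg_seven`),
  `w_K = 2` (`torsionOrder_eq_two`), so **every unit of `𝓞_K` is `±1`** (`units_eq_one_or_eq_neg_one`); an integer in no prime is a unit;
  the integer `α = (1 + θ)/2` with `α(1 − α) = 2` (`exists_mul_one_sub_eq_two`) gives `β ∈ {α, 1 − α}` with `β(1−β) = 2`, `β ∈ v̄`
  (`exists_mul_one_sub_eq_two_mem`);
* §2 valuations on a frame (the member `C • W = cm7^{(d)}` only feeds `e(v∣2) = e(v̄∣2) = 1`, -w3 g7 `ramificationIdx_eq_one_of_frame`):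
  `ord_w 2 = 1` at `w ∋ 2` (`intValuation_two_of_frame`), `ord_{v̄} β = 1`, `ord_{v̄}(1−β) = 0` (`intValuation_vbar`), `ord_v β = 0`,
  `ord_v (1−β) = 1` (`intValuation_v` — uses the units), `β`, `1 − β` units off `2`, and the two uniformizers `β − 1²`, `−1 − 1²` at `v`
  that feed file 2's wild lemma.
presearch: Cox §7.A (`w(−7) = 2`, `h(−7) = 1`), Marcus Ch. 2 Thm. 1, Neukirch I (8.2) — held; no new Literature fact. beyond-print theorem: no.

References: [Cox2013] §2.A, §7.A, Thm. 7.7(ii); [Marcus2018] Ch. 2 Thm. 1; [NeukirchANT1999] Ch. I §7 (7.4), §8 (8.2);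
[SilvermanATAEC1994] App. A §3.
-/

noncomputable section

open scoped Classical NumberField

set_option linter.dupNamespace false
set_option autoImplicit false

open NumberField IsDedekindDomain Field WeierstrassCurve
open Literature.NumberTheory Literature.NumberTheory.EllipticCurves Literature.NumberTheory.GaloisRepresentations
open Summit.BirchSwinnertonDyer.BirchSwinnertonDyer.Theorems.PrintCf2.AdditiveAtSeven
open Summit.BirchSwinnertonDyer.BirchSwinnertonDyer.Theorems.PrintCf2.ReductionTypesOverK

namespace Summit.BirchSwinnertonDyer.BirchSwinnertonDyer.Theorems.PrintCf2.FirstLayer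

variable {K : Type} [Field K] [NumberField K]

/-! ## §1. The frame field `ℚ(√−7)`: discriminant, class number, units, the integer `α = (1+θ)/2` -/

section Field

/-- `d_K = −7` for an imaginary quadratic field containing `√−7` (`−7 ≡ 1 (mod 4)` squarefree). [cite: Marcus2018, Ch. 2 Thm. 1] -/
theorem discr_eq_neg_seven (hK : IsImaginaryQuadratic K) {θ : K} (hθ : θ ^ 2 = -7) : NumberField.discr K = -7 :=
  QuadraticFields.Quadratic.discr_eq_of_sq_eq_intCast hK.1 (θ := θ) (D := -7) (by rw [hθ]; norm_num) (by decide)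
    (Int.prime_iff_natAbs_prime.mpr (by norm_num)).squarefree (by decide)

/-- `h_K = 1`: `𝓞_K` is a principal ideal ring (`h(−7) = 1`, Cox Thm. 7.7(ii)). [cite: Cox2013, §7.B Thm. 7.7(ii) and §2.A] -/
theorem isPrincipalIdealRing_of_sq_eq_neg_seven (hK : IsImaginaryQuadratic K) {θ : K} (hθ : θ ^ 2 = -7) :
    IsPrincipalIdealRing (𝓞 K) := by
  have h := QuadraticFields.Quadratic.card_reducedForms_eq_classNumber hK.1 hK.discr_neg
  rw [discr_eq_neg_seven hK hθ] at h
  have h7 : QuadraticFields.BinaryQuadraticForm.classNumber (-7) = 1 := by decide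
  exact (classNumber_eq_one_iff (K := K)).1 (by rw [← h, h7])

/-- `w_K = 2` (`d_K = −7 < −4`). [cite: Cox2013, §7.A] -/
theorem torsionOrder_eq_two (hK : IsImaginaryQuadratic K) {θ : K} (hθ : θ ^ 2 = -7) : Units.torsionOrder K = 2 :=
  DiophantineGeometry.torsionOrder_eq_two_of_discr_lt hK.1 (by rw [discr_eq_neg_seven hK hθ]; norm_num)

/-- **Every unit of `𝓞_K` is `±1`** (`K` imaginary quadratic: the unit group is torsion, Dirichlet; `w_K = 2`).
[cite: NeukirchANT1999, Ch. I §7 Thm. (7.4)] [cite: Cox2013, §7.A] -/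
theorem units_eq_one_or_eq_neg_one (hK : IsImaginaryQuadratic K) {θ : K} (hθ : θ ^ 2 = -7) (u : (𝓞 K)ˣ) :
    u = 1 ∨ u = -1 := by
  haveI : IsTotallyComplex K := hK.2
  have hmem := ComplexMultiplication.units_mem_torsion_of_finrank_eq_two (k := K) hK.1 u
  rw [← Units.rootsOfUnity_eq_torsion, torsionOrder_eq_two hK hθ, mem_rootsOfUnity] at hmem
  have h2 : (u : 𝓞 K) * (u : 𝓞 K) = 1 := by
    rw [← sq, ← Units.val_pow_eq_pow_val, hmem, Units.val_one]
  rcases mul_self_eq_one_iff.mp h2 with h | h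
  · exact Or.inl (Units.val_eq_one.mp h)
  · exact Or.inr (Units.val_inj.mp (by rw [h, Units.val_neg, Units.val_one]))

omit [NumberField K] in
/-- A non-zero integer lying in no height-one prime is a unit. [folklore] -/
theorem isUnit_of_forall_notMem {x : 𝓞 K} (hx : x ≠ 0) (h : ∀ w : HeightOneSpectrum (𝓞 K), x ∉ w.asIdeal) : IsUnit x := by
  by_contra hu
  have hne : Ideal.span {x} ≠ ⊤ := by rwa [Ne, Ideal.span_singleton_eq_top]
  obtain ⟨m, hm, hle⟩ := Ideal.exists_le_maximal _ hne
  have hmne : m ≠ ⊥ := by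
    intro h0
    have : x ∈ m := hle (Ideal.mem_span_singleton_self x)
    rw [h0, Ideal.mem_bot] at this
    exact hx this
  exact h ⟨m, hm.isPrime, hmne⟩ (hle (Ideal.mem_span_singleton_self x))

/-- **The integer `α = (1 + θ)/2`** (`θ² = −7`): a root of `X² − X + 2`, so `α(1 − α) = 2` in `𝓞_K`.
[cite: SilvermanATAEC1994, App. A §3 (𝓞 = ℤ[(1+√−7)/2])] -/
theorem exists_mul_one_sub_eq_two {θ : K} (hθ : θ ^ 2 = -7) : ∃ α : 𝓞 K, (α : K) = (1 + θ) / 2 ∧ α * (1 - α) = 2 := by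
  have hrel : ((1 + θ) / 2) ^ 2 + ((-1 : ℤ) : K) * ((1 + θ) / 2) + ((2 : ℤ) : K) = 0 := by
    push_cast
    linear_combination hθ / 4
  have hint : _root_.IsIntegral ℤ ((1 + θ) / 2) := by
    refine ⟨Polynomial.X ^ 2 + Polynomial.C (-1 : ℤ) * Polynomial.X + Polynomial.C 2, ?_, ?_⟩
    · rw [add_assoc]
      refine (Polynomial.monic_X_pow 2).add_of_left (lt_of_le_of_lt Polynomial.degree_linear_le ?_)
      rw [Polynomial.degree_X_pow]
      norm_num
    · rw [Polynomial.eval₂_add, Polynomial.eval₂_add, Polynomial.eval₂_pow, Polynomial.eval₂_mul,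
        Polynomial.eval₂_C, Polynomial.eval₂_X, Polynomial.eval₂_C, eq_intCast, eq_intCast]
      exact hrel
  refine ⟨⟨(1 + θ) / 2, hint⟩, rfl, ?_⟩
  apply RingOfIntegers.ext
  push_cast
  change (1 + θ) / 2 * (1 - (1 + θ) / 2) = 2
  linear_combination (-hθ) / 4

/-- **A generator of `v̄`**: for a prime `v̄ ∋ 2` there is `β ∈ 𝓞_K` with `β(1 − β) = 2` and `β ∈ v̄` (one of `α`, `1 − α`).
[cite: SilvermanATAEC1994, App. A §3] -/
theorem exists_mul_one_sub_eq_two_mem {θ : K} (hθ : θ ^ 2 = -7) {vbar : HeightOneSpectrum (𝓞 K)}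
    (hvbar : ((2 : ℕ) : 𝓞 K) ∈ vbar.asIdeal) : ∃ β : 𝓞 K, β * (1 - β) = 2 ∧ β ∈ vbar.asIdeal := by
  obtain ⟨α, -, hα⟩ := exists_mul_one_sub_eq_two hθ
  have h2 : α * (1 - α) ∈ vbar.asIdeal := by rw [hα]; exact_mod_cast hvbar
  rcases vbar.isPrime.mem_or_mem h2 with h | h
  · exact ⟨α, hα, h⟩
  · exact ⟨1 - α, by rw [sub_sub_cancel, mul_comm, hα], h⟩

end Field

/-! ## §2. Valuations on a frame: `ord 2 = 1` at `v`, `v̄`; the generator `β` of `v̄` -/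

section Valuations

open Rat.HeightOneSpectrum

/-- In `ℤᵐ⁰`: `a, b ≤ 1` and `a·b = 1` force `a = 1`. [folklore] -/
theorem eq_one_of_mul_eq_one_of_le {a b : WithZero (Multiplicative ℤ)} (ha : a ≤ 1) (hb : b ≤ 1) (hab : a * b = 1) :
    a = 1 :=
  le_antisymm ha (by calc (1 : WithZero (Multiplicative ℤ)) = a * b := hab.symm
    _ ≤ a * 1 := mul_le_mul' le_rfl hb
    _ = a := mul_one a)

/-- **`ord_w 2 = 1` at every place `w ∋ 2` of a frame** (`e(w∣2) = 1`: -w3 g7 `ramificationIdx_eq_one_of_frame`, the rational prime below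
`w` is `2 ≠ 7`; then `|2|_w = |2|_2^{e} = exp(−1)`). [cite: NeukirchANT1999, Ch. I §8 Prop. (8.2)] -/
theorem intValuation_two_of_frame (hK : IsImaginaryQuadratic K) {θ : K} (hθ : θ ^ 2 = -7) {d : ℤ} (hd0 : d ≠ 0)
    (W : WeierstrassCurve ℚ) [W.IsElliptic] {C : VariableChange ℚ} (hC : C • W = cm7.quadraticTwist (d : ℚ))
    {w : HeightOneSpectrum (𝓞 K)} (hw : ((2 : ℕ) : 𝓞 K) ∈ w.asIdeal) :
    w.intValuation (2 : 𝓞 K) = WithZero.exp (-1 : ℤ) := by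
  have h2u : ((2 : ℕ) : 𝓞 ℚ) ∈ (w.under (𝓞 ℚ)).asIdeal := by
    change ((2 : ℕ) : 𝓞 ℚ) ∈ Ideal.comap (algebraMap (𝓞 ℚ) (𝓞 K)) w.asIdeal
    rw [Ideal.mem_comap, map_natCast]
    exact hw
  have hgen : natGenerator (w.under (𝓞 ℚ)) = 2 :=
    ((Nat.prime_dvd_prime_iff_eq (prime_natGenerator _) Nat.prime_two).mp ((Rat.natCast_mem_asIdeal_iff _).mp h2u))
  have he := ramificationIdx_eq_one_of_frame K hK hθ hd0 W hC (w := w) (by rw [hgen]; norm_num)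
  have hval := valuation_algebraMap_eq_pow_ramificationIdx K w (2 : ℚ)
  rw [he, pow_one] at hval
  have hnat : (w.under (𝓞 ℚ)).valuation ℚ (2 : ℚ) = WithZero.exp (-1 : ℤ) := by
    have := Rat.valuation_natGenerator (w.under (𝓞 ℚ))
    rwa [hgen, Nat.cast_ofNat] at this
  rw [hnat, map_ofNat] at hval
  rw [← hval]
  have : (2 : K) = algebraMap (𝓞 K) K 2 := by rw [map_ofNat]
  rw [this, HeightOneSpectrum.valuation_of_algebraMap]

variable {v vbar : HeightOneSpectrum (𝓞 K)} {β : 𝓞 K}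

/-- At a place `w ∤ 2`: `β` and `1 − β` are units (`β(1−β) = 2`). [folklore] -/
theorem intValuation_eq_one_of_two_notMem (hβ : β * (1 - β) = 2) {w : HeightOneSpectrum (𝓞 K)}
    (hw : ((2 : ℕ) : 𝓞 K) ∉ w.asIdeal) : w.intValuation β = 1 ∧ w.intValuation (1 - β) = 1 := by
  have h2 : w.intValuation (2 : 𝓞 K) = 1 := (w.intValuation_eq_one_iff).mpr (by exact_mod_cast hw)
  rw [← hβ, map_mul] at h2
  exact ⟨eq_one_of_mul_eq_one_of_le (w.intValuation_le_one _) (w.intValuation_le_one _) h2,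
    eq_one_of_mul_eq_one_of_le (w.intValuation_le_one _) (w.intValuation_le_one _) (by rwa [mul_comm] at h2)⟩

/-- **At `v̄ ∋ β`: `ord_{v̄} β = 1` and `ord_{v̄} (1 − β) = 0`** (`β(1−β) = 2`, `ord_{v̄} 2 = 1`). [cite: NeukirchANT1999, Ch. I §8 Prop. (8.2)] -/
theorem intValuation_vbar (h2 : vbar.intValuation (2 : 𝓞 K) = WithZero.exp (-1 : ℤ)) (hβ : β * (1 - β) = 2)
    (hβvbar : β ∈ vbar.asIdeal) :
    vbar.intValuation β = WithZero.exp (-1 : ℤ) ∧ vbar.intValuation (1 - β) = 1 := by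
  rw [← hβ, map_mul] at h2
  have hle : vbar.intValuation β ≤ WithZero.exp (-((1 : ℕ) : ℤ)) := by
    rw [HeightOneSpectrum.intValuation_le_pow_iff_mem, pow_one]; exact hβvbar
  have hle' : WithZero.exp (-1 : ℤ) ≤ vbar.intValuation β := by
    calc WithZero.exp (-1 : ℤ) = vbar.intValuation β * vbar.intValuation (1 - β) := h2.symm
      _ ≤ vbar.intValuation β * 1 := mul_le_mul' le_rfl (vbar.intValuation_le_one _)
      _ = vbar.intValuation β := mul_one _
  have hβ1 : vbar.intValuation β = WithZero.exp (-1 : ℤ) := le_antisymm (by exact_mod_cast hle) hle'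
  refine ⟨hβ1, ?_⟩
  rw [hβ1] at h2
  have hne : WithZero.exp (-1 : ℤ) ≠ 0 := WithZero.coe_ne_zero
  calc vbar.intValuation (1 - β) = (WithZero.exp (-1 : ℤ))⁻¹ * (WithZero.exp (-1 : ℤ) * vbar.intValuation (1 - β)) := by
        rw [← mul_assoc, inv_mul_cancel₀ hne, one_mul]
    _ = 1 := by rw [h2, inv_mul_cancel₀ hne]

/-- **At the other place `v ∋ 2`: `ord_v β = 0` and `ord_v (1 − β) = 1`** — `β ∉ v`, for otherwise `1 − β` would lie in no prime
(not in `v`, not in `v̄`, a unit off `2`; every place above `2` is `v` or `v̄` in the quadratic field), hence be a unit `±1`, i.e.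
`β ∈ {0, 2}`, contradicting `β(1−β) = 2`. [cite: NeukirchANT1999, Ch. I §8 Prop. (8.2)] -/
theorem intValuation_v (hK : IsImaginaryQuadratic K) {θ : K} (hθ : θ ^ 2 = -7) (hv : ((2 : ℕ) : 𝓞 K) ∈ v.asIdeal)
    (hvbar : ((2 : ℕ) : 𝓞 K) ∈ vbar.asIdeal) (hne : vbar ≠ v) (h2v : v.intValuation (2 : 𝓞 K) = WithZero.exp (-1 : ℤ))
    (h2vbar : vbar.intValuation (2 : 𝓞 K) = WithZero.exp (-1 : ℤ)) (hβ : β * (1 - β) = 2) (hβvbar : β ∈ vbar.asIdeal) :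
    v.intValuation β = 1 ∧ v.intValuation (1 - β) = WithZero.exp (-1 : ℤ) := by
  have hβv : β ∉ v.asIdeal := by
    intro hβv
    have h1v : (1 - β) ∉ v.asIdeal := fun h ↦ v.isPrime.ne_top
      ((Ideal.eq_top_iff_one _).mpr (by simpa using v.asIdeal.add_mem h hβv))
    have h1vbar : (1 - β) ∉ vbar.asIdeal := by
      rw [← HeightOneSpectrum.intValuation_lt_one_iff_mem, (intValuation_vbar h2vbar hβ hβvbar).2]
      exact lt_irrefl _
    have hunit : IsUnit (1 - β) := by
      refine isUnit_of_forall_notMem (fun h0 ↦ ?_) fun w ↦ ?_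
      · rw [h0, mul_zero] at hβ; exact two_ne_zero hβ.symm
      · by_cases hw : ((2 : ℕ) : 𝓞 K) ∈ w.asIdeal
        · rcases CMPrimes.eq_or_eq_of_two_mem K hK.1 hv hvbar hne hw with rfl | rfl
          · exact h1v
          · exact h1vbar
        · rw [← HeightOneSpectrum.intValuation_lt_one_iff_mem, (intValuation_eq_one_of_two_notMem hβ hw).2]
          exact lt_irrefl _
    rcases units_eq_one_or_eq_neg_one hK hθ hunit.unit with h | h
    · have h' : 1 - β = 1 := by rw [← hunit.unit_spec, h, Units.val_one]
      have hβ0 : β = 0 := by simpa using h'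
      rw [hβ0, zero_mul] at hβ
      exact two_ne_zero hβ.symm
    · have h' : 1 - β = -1 := by rw [← hunit.unit_spec, h, Units.val_neg, Units.val_one]
      have hβ2 : β = 2 := by linear_combination -h'
      rw [hβ2] at hβ
      norm_num at hβ
  have hvβ : v.intValuation β = 1 := (v.intValuation_eq_one_iff).mpr hβv
  refine ⟨hvβ, ?_⟩
  have h := h2v
  rw [← hβ, map_mul, hvβ, one_mul] at h
  exact h

/-- **`−β′ = β − 1²` is a uniformizer at `v`** (input of file 2's wild lemma for `K(√β)`). [folklore] -/
theorem intValuation_sub_one_sq (h : v.intValuation (1 - β) = WithZero.exp (-1 : ℤ)) :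
    v.intValuation (β - 1 ^ 2) = WithZero.exp (-1 : ℤ) := by
  rw [one_pow, ← neg_sub, Valuation.map_neg, h]

/-- **`−2 = −1 − 1²` is a uniformizer at `v`** (input of file 2's wild lemma for `K(√−1)`). [folklore] -/
theorem intValuation_neg_one_sub_one_sq (h : v.intValuation (2 : 𝓞 K) = WithZero.exp (-1 : ℤ)) :
    v.intValuation ((-1 : 𝓞 K) - 1 ^ 2) = WithZero.exp (-1 : ℤ) := by
  rw [show ((-1 : 𝓞 K) - 1 ^ 2) = -2 by norm_num, Valuation.map_neg, h]

end Valuations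

end Summit.BirchSwinnertonDyer.BirchSwinnertonDyer.Theorems.PrintCf2.FirstLayer

end
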